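import Mathlib
import HarnessLib
import Summits.ValiantsHypothesis.ValiantsHypothesis.Theorems.LacunarySymmetroidMatrixDescartesProductPlusOneMixedSigned
import Summits.ValiantsHypothesis.ValiantsHypothesis.Theorems.LacunarySymmetroidMatrixDescartesProductPlusOneLowerSignedCalculus

/-!
# ValiantsHypothesis / LacunarySymmetroid — crux `MatrixDescartes` (stmt-ValiantsHypothesis-18050, V1),
# LINE (A) «product_plus_one»: the LOWER-SIGNED SECTOR, EVERY `K` — MEMBERS, SIGN-AWARE: `Z₊ ≤ #{sign-changing factors} + 2`

On `…LowerSignedCalculus` (`hasDerivAt_lowerSignedXi`: the top-chart level function `Ξ_j = (X f_j′ − d_0 f_j)/(x^w f_j)`, `w = d_{K−1} − d_0`,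
of a LOWER-SIGNED factor — coefficients below the top letter weakly one-signed, top free — has derivative `≤ 0`, `< 0` unless `f_j = a_0 X^{d_0}`)
and p7 g14's gap parity (✓ `card_pos_roots_le_countP_add_two`, `…MixedSigned`), following ✓ `…CoherentKMembers` line by line:
`lowerSigned_countP_pos_roots_le_one` (≤ 1 positive zero WITH multiplicity: Mathlib's Descartes `roots_countP_pos_le_signVariations` +
✓ `signVariations_le_one_of_top`), `lowerSigned_countP_pos_roots_eq_zero` (no sign change ⇒ none), ★ `lowerSignedK_sector_pos_roots_signed`
(range-indexed: `Z₊(κ X^{m d_0} + ∏ f_j) ≤ S + 2`, `S` = number of SIGN-CHANGING factors), ★★ `lowerSigned_sector_classK_signed` (LINE SHAPE,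
every `K ≥ 2`, every strictly increasing support, bottom coupling: `Z₊(C c·X^{m d_0} + ∏ f_j) ≤ #{j : ∃ l < K−1, a j l · a j (K−1) < 0} + 2` —
`≤ 2` when no factor changes sign (S3's constant at the class coupling), `≤ m + 2` always (✓ `coherent_sector_classK_signed`'s constant, now
for the whole lower-signed sector and its mixtures)), `classRowK3_lowerSigned_signed` (the `K = 3` row).
HONEST FRAMING: a sector constant; NOT `stub_classRowK3` / `stub_polyLaw` / `ProductPlusOneMDR` / `MatrixDescartes` / Conjecture B;
`VP ≠ VNP` is NOT proved.  No definitions, no named facts.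
-/

set_option linter.dupNamespace false

namespace Summit.ValiantsHypothesis.ValiantsHypothesis.Theorems.LacunarySymmetroidMatrixDescartes

namespace ProductPlusOne

open Polynomial Finset
open scoped BigOperators

/-! ### §M Members, sign-aware: `Z₊ ≤ #{sign-changing factors} + 2` -/

/-- A lower-signed sparse factor has at most ONE positive zero counted WITH multiplicity (Descartes: at most one sign variation, at the
top letter). [folklore] -/
theorem lowerSigned_countP_pos_roots_le_one (T : ℕ) (d : ℕ → ℕ) (hd : StrictMono d) (c : ℕ → ℝ)
    (hls : (∀ i, i < T → 0 ≤ c i) ∨ (∀ i, i < T → c i ≤ 0)) :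
    (∑ i ∈ Finset.range (T + 1), C (c i) * X ^ (d i) : ℝ[X]).roots.countP (fun t => 0 < t) ≤ 1 := by
  classical
  have key : ∀ c' : ℕ → ℝ, (∀ i, i < T → 0 ≤ c' i) →
      (∑ i ∈ Finset.range (T + 1), C (c' i) * X ^ (d i) : ℝ[X]).roots.countP (fun t => 0 < t) ≤ 1 := by
    intro c' hnn
    refine (roots_countP_pos_le_signVariations _).trans ?_
    refine signVariations_le_one_of_top _ (d T) (fun k hk => ?_) (fun k hk => ?_)
    · rw [finsetSum_coeff]
      refine Finset.sum_nonneg (fun i hi => ?_)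
      rw [coeff_C_mul_X_pow]
      split_ifs with h
      · have hiT : i < T := by
          rcases Nat.lt_or_ge i T with h' | h'
          · exact h'
          · exfalso
            have : i = T := by have := Finset.mem_range.mp hi; omega
            exact hk (by rw [h, this])
        exact hnn i hiT
      · exact le_rfl
    · rw [finsetSum_coeff]
      refine Finset.sum_eq_zero (fun i hi => ?_)
      rw [coeff_C_mul_X_pow, if_neg]
      intro h
      have hle : d i ≤ d T := hd.monotone (by have := Finset.mem_range.mp hi; omega)
      omega
  rcases hls with h | h
  · exact key c h
  · have e1 : (∑ i ∈ Finset.range (T + 1), C (c i) * X ^ (d i) : ℝ[X])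
        = -(∑ i ∈ Finset.range (T + 1), C ((fun i => -c i) i) * X ^ (d i)) := by
      rw [← Finset.sum_neg_distrib]
      refine Finset.sum_congr rfl (fun i _ => ?_)
      simp only [map_neg, neg_mul, neg_neg]
    rw [e1, roots_neg]
    exact key (fun i => -c i) (fun i hi => by have := h i hi; linarith)

/-- A lower-signed sparse factor WITHOUT a sign change (no lower coefficient of sign opposite to the top one) has NO positive zero.
[folklore] -/
theorem lowerSigned_countP_pos_roots_eq_zero (T : ℕ) (d : ℕ → ℕ) (c : ℕ → ℝ)
    (hls : (∀ i, i < T → 0 ≤ c i) ∨ (∀ i, i < T → c i ≤ 0)) (hns : ∀ i, i < T → 0 ≤ c i * c T) :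
    (∑ i ∈ Finset.range (T + 1), C (c i) * X ^ (d i) : ℝ[X]).roots.countP (fun t => 0 < t) = 0 := by
  classical
  -- all coefficients are weakly one-signed
  have hall : (∀ i, i < T + 1 → 0 ≤ c i) ∨ (∀ i, i < T + 1 → c i ≤ 0) := by
    rcases le_or_gt 0 (c T) with hT | hT
    · rcases hls with h | h
      · exact Or.inl fun i hi => by
          rcases Nat.lt_or_ge i T with h' | h'
          · exact h i h'
          · rw [show i = T by omega]; exact hT
      · rcases hT.lt_or_eq with hT' | hT'
        · exact Or.inl fun i hi => by
            rcases Nat.lt_or_ge i T with h' | h'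
            · have h1 := hns i h'; have h2 := h i h'; nlinarith
            · rw [show i = T by omega]; exact hT
        · exact Or.inr fun i hi => by
            rcases Nat.lt_or_ge i T with h' | h'
            · exact h i h'
            · rw [show i = T by omega, ← hT']
    · rcases hls with h | h
      · exact Or.inr fun i hi => by
          rcases Nat.lt_or_ge i T with h' | h'
          · have h1 := hns i h'; have h2 := h i h'; nlinarith
          · rw [show i = T by omega]; exact hT.le
      · exact Or.inr fun i hi => by
          rcases Nat.lt_or_ge i T with h' | h'
          · exact h i h'
          · rw [show i = T by omega]; exact hT.le
  have key : ∀ c' : ℕ → ℝ, (∀ i, i < T + 1 → 0 ≤ c' i) →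
      (∑ i ∈ Finset.range (T + 1), C (c' i) * X ^ (d i) : ℝ[X]).roots.countP (fun t => 0 < t) = 0 := by
    intro c' hnn
    have hV : (∑ i ∈ Finset.range (T + 1), C (c' i) * X ^ (d i) : ℝ[X]).signVariations = 0 := by
      refine signVariations_eq_zero_of_coeff_nonneg _ _ le_rfl (fun k => ?_)
      rw [finsetSum_coeff]
      refine Finset.sum_nonneg (fun i hi => ?_)
      rw [coeff_C_mul_X_pow]
      split_ifs; exacts [hnn i (Finset.mem_range.mp hi), le_rfl]
    exact Nat.le_zero.mp (hV ▸ roots_countP_pos_le_signVariations (∑ i ∈ Finset.range (T + 1), C (c' i) * X ^ (d i) : ℝ[X]))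
  rcases hall with h | h
  · exact key c h
  · have e1 : (∑ i ∈ Finset.range (T + 1), C (c i) * X ^ (d i) : ℝ[X])
        = -(∑ i ∈ Finset.range (T + 1), C ((fun i => -c i) i) * X ^ (d i)) := by
      rw [← Finset.sum_neg_distrib]
      refine Finset.sum_congr rfl (fun i _ => ?_)
      simp only [map_neg, neg_mul, neg_neg]
    rw [e1, roots_neg]
    exact key (fun i => -c i) (fun i hi => by have := h i hi; linarith)

/-- ★ **THE LOWER-SIGNED SECTOR, MEMBERS, SIGN-AWARE** (range-indexed; `T ≥ 1`, bottom coupling `N = m·d_0`):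
`Z₊(κ X^{m d_0} + ∏_j f_j) ≤ S + 2`, `S` = the number of SIGN-CHANGING factors (a lower coefficient opposite in sign to the top one). -/
theorem lowerSignedK_sector_pos_roots_signed {m : ℕ} (T : ℕ) (hT : 1 ≤ T) (d : ℕ → ℕ) (hd : StrictMono d) (c : Fin m → ℕ → ℝ)
    (hls : ∀ j, (∀ i, i < T → 0 ≤ c j i) ∨ (∀ i, i < T → c j i ≤ 0)) (κ : ℝ) :
    ((C κ * X ^ (m * d 0) + ∏ j, (∑ i ∈ Finset.range (T + 1), C (c j i) * X ^ (d i) : ℝ[X])).roots.toFinset.filter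
      (fun t => 0 < t)).card ≤ (Finset.univ.filter (fun j => ∃ i, i < T ∧ c j i * c j T < 0)).card + 2 := by
  classical
  set S := (Finset.univ.filter (fun j : Fin m => ∃ i, i < T ∧ c j i * c j T < 0)).card with hSdef
  set P : ℝ[X] := ∏ j, (∑ i ∈ Finset.range (T + 1), C (c j i) * X ^ (d i) : ℝ[X]) with hPdef
  -- no positive zero of a polynomial of the form `C a * X^n`
  have hmono0 : ∀ (a : ℝ) (n : ℕ), ((C a * X ^ n : ℝ[X]).roots.toFinset.filter (fun t => 0 < t)).card = 0 := by
    intro a n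
    by_cases ha : a = 0
    · rw [ha]; simp
    · rw [roots_C_mul_X_pow ha, Finset.card_eq_zero]
      ext t
      simp only [Finset.mem_filter, Multiset.mem_toFinset, Multiset.mem_nsmul, Multiset.mem_singleton,
        Finset.notMem_empty, iff_false, not_and, not_lt]
      rintro ⟨_, rfl⟩
      exact le_rfl
  -- a vanishing product
  by_cases hP0 : P = 0
  · rw [hP0, add_zero, hmono0]; exact Nat.zero_le _
  have hne : ∀ j, (∑ i ∈ Finset.range (T + 1), C (c j i) * X ^ (d i) : ℝ[X]) ≠ 0 := by
    intro j h
    apply hP0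
    exact Finset.prod_eq_zero (Finset.mem_univ j) h
  -- multiplicity of the positive zeros of P: ≤ S
  have hone : ∀ j, ((∑ i ∈ Finset.range (T + 1), C (c j i) * X ^ (d i) : ℝ[X])).roots.countP (fun t => 0 < t)
      ≤ if (∃ i, i < T ∧ c j i * c j T < 0) then 1 else 0 := by
    intro j
    split_ifs with hsc
    · exact lowerSigned_countP_pos_roots_le_one T d hd (c j) (hls j)
    · push Not at hsc
      exact (lowerSigned_countP_pos_roots_eq_zero T d (c j) (hls j) hsc).le
  have hmult : P.roots.countP (fun t => 0 < t) ≤ S := by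
    have key : ∀ s : Finset (Fin m),
        (∏ j ∈ s, (∑ i ∈ Finset.range (T + 1), C (c j i) * X ^ (d i) : ℝ[X])).roots.countP (fun t => 0 < t)
          ≤ ∑ j ∈ s, (if (∃ i, i < T ∧ c j i * c j T < 0) then 1 else 0) := by
      intro s
      induction s using Finset.induction_on with
      | empty => simp
      | @insert a s ha ih =>
        rw [Finset.prod_insert ha, roots_mul (mul_ne_zero (hne a) (Finset.prod_ne_zero_iff.mpr (fun j _ => hne j))),
          Multiset.countP_add, Finset.sum_insert ha]
        have h1 := hone a
        omega
    have := key Finset.univ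
    rwa [hSdef, Finset.card_filter]
  by_cases hκ : κ = 0
  · subst hκ
    rw [map_zero, zero_mul, zero_add]
    exact ((StubVLawTwo.card_filter_pos_le_countP P).trans hmult).trans (by omega)
  -- every factor a bottom monomial: the member is a monomial
  by_cases hdeg : ∃ j, ∃ i, 0 < i ∧ i < T + 1 ∧ c j i ≠ 0
  swap
  · push Not at hdeg
    have hfac : ∀ j, (∑ i ∈ Finset.range (T + 1), C (c j i) * X ^ (d i) : ℝ[X]) = C (c j 0) * X ^ (d 0) := by
      intro j
      rw [Finset.sum_range_succ']
      have : ∑ i ∈ Finset.range T, C (c j (i + 1)) * X ^ (d (i + 1)) = (0 : ℝ[X]) :=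
        Finset.sum_eq_zero fun i hi => by
          rw [hdeg j (i + 1) (Nat.succ_pos i) (by have := Finset.mem_range.1 hi; omega)]; simp
      rw [this, zero_add]
    have hP : P = C (∏ j, c j 0) * X ^ (m * d 0) := by
      rw [hPdef, Finset.prod_congr rfl (fun j _ => hfac j), Finset.prod_mul_distrib, map_prod C, Finset.prod_const,
        Finset.card_univ, Fintype.card_fin, ← pow_mul]
      ring_nf
    have : C κ * X ^ (m * d 0) + P = C (κ + ∏ j, c j 0) * X ^ (m * d 0) := by rw [hP, map_add]; ring
    rw [this, hmono0]; exact Nat.zero_le _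
  obtain ⟨j₀, i₀, hi₀0, hi₀T, hci₀⟩ := hdeg
  have hmain := card_pos_roots_le_countP_add_two P hP0 κ hκ (m * d 0) ?_
  · exact hmain.trans (by omega)
  -- no three member zeros in a zero-free interval of P
  intro z₁ hz₁ z₂ hz₂ z₃ hz₃ h12 h23 free13
  have hSmem : ∀ z ∈ (C κ * X ^ (m * d 0) + P).roots.toFinset.filter (fun t => 0 < t),
      0 < z ∧ eval z (C κ * X ^ (m * d 0) + P) = 0 := by
    intro z hz
    rw [mem_filter, Multiset.mem_toFinset] at hz
    by_cases h0 : C κ * X ^ (m * d 0) + P = 0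
    · rw [h0, roots_zero] at hz
      exact absurd hz.1 (Multiset.notMem_zero _)
    · exact ⟨hz.2, (IsRoot.def).mp ((mem_roots h0).mp hz.1)⟩
  have hfacne : ∀ t, eval t P ≠ 0 → ∀ j, (∑ i ∈ Finset.range (T + 1), C (c j i) * X ^ (d i) : ℝ[X]).eval t ≠ 0 := by
    intro t ht j hj
    apply ht
    rw [hPdef, eval_prod, Finset.prod_eq_zero_iff]
    exact ⟨j, mem_univ _, hj⟩
  have hz₁pos := (hSmem z₁ hz₁).1
  obtain ⟨w₁, hw₁, hd₁⟩ := exists_root_euler_between (C κ * X ^ (m * d 0) + P) (m * d 0) hz₁pos h12 (hSmem z₁ hz₁).2 (hSmem z₂ hz₂).2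
  obtain ⟨w₂, hw₂, hd₂⟩ :=
    exists_root_euler_between (C κ * X ^ (m * d 0) + P) (m * d 0) (hz₁pos.trans h12) h23 (hSmem z₂ hz₂).2 (hSmem z₃ hz₃).2
  have hw₁pos : 0 < w₁ := hz₁pos.trans hw₁.1
  have hw₁₂ : w₁ < w₂ := hw₁.2.trans hw₂.1
  have hIcc : Set.Icc w₁ w₂ ⊆ Set.Icc z₁ z₃ := fun t ht => ⟨hw₁.1.le.trans ht.1, ht.2.trans hw₂.2.le⟩
  have hfree : ∀ t ∈ Set.Icc w₁ w₂, ∀ j, (∑ i ∈ Finset.range (T + 1), C (c j i) * X ^ (d i) : ℝ[X]).eval t ≠ 0 :=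
    fun t ht j => hfacne t (free13 t (hIcc ht)) j
  -- level condition at a zero of X h′ − N h off the zeros of P
  have hlevelΦ : ∀ w : ℝ, 0 < w → eval w P ≠ 0 →
      eval w (X * derivative (C κ * X ^ (m * d 0) + P) - C ((m * d 0 : ℕ) : ℝ) * (C κ * X ^ (m * d 0) + P)) = 0 →
      (∑ j, w * (derivative (∑ i ∈ Finset.range (T + 1), C (c j i) * X ^ (d i) : ℝ[X])).eval w
          / (∑ i ∈ Finset.range (T + 1), C (c j i) * X ^ (d i) : ℝ[X]).eval w) = (m : ℝ) * (d 0 : ℝ) := by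
    intro w hw hPw hd0
    have hE : X * derivative (C κ * X ^ (m * d 0) + P) - C ((m * d 0 : ℕ) : ℝ) * (C κ * X ^ (m * d 0) + P)
        = X * derivative P - C ((m * d 0 : ℕ) : ℝ) * P := by
      have h := euler_sub_monomial P (-κ) (m * d 0)
      rw [map_neg] at h
      rw [show C κ * X ^ (m * d 0) + P = P - -C κ * X ^ (m * d 0) by ring]
      exact h
    rw [hE, eval_sub, eval_mul, eval_X, eval_mul, eval_C, hPdef,
      eval_euler_prod_general _ (hfacne w hPw), ← eval_prod] at hd0
    rw [hPdef] at hPw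
    have : eval w (∏ j, (∑ i ∈ Finset.range (T + 1), C (c j i) * X ^ (d i) : ℝ[X])) *
        ((∑ j, w * (derivative (∑ i ∈ Finset.range (T + 1), C (c j i) * X ^ (d i) : ℝ[X])).eval w
          / (∑ i ∈ Finset.range (T + 1), C (c j i) * X ^ (d i) : ℝ[X]).eval w) - (m : ℝ) * (d 0 : ℝ)) = 0 := by
      rw [mul_sub]; push_cast at hd0; linarith
    rcases mul_eq_zero.mp this with h1 | h1
    · exact absurd h1 hPw
    linarith
  have h1 := hlevelΦ w₁ hw₁pos (free13 w₁ (hIcc ⟨le_rfl, hw₁₂.le⟩)) hd₁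
  have h2 := hlevelΦ w₂ (hw₁pos.trans hw₁₂) (free13 w₂ (hIcc ⟨hw₁₂.le, le_rfl⟩)) hd₂
  -- the top-chart weighted level function Ξ and Rolle
  set Ξ : ℝ → ℝ := fun y => ∑ j, (X * derivative (∑ i ∈ Finset.range (T + 1), C (c j i) * X ^ (d i) : ℝ[X])
      - C ((d 0 : ℕ) : ℝ) * ∑ i ∈ Finset.range (T + 1), C (c j i) * X ^ (d i)).eval y
      / (y ^ (d T - d 0) * (∑ i ∈ Finset.range (T + 1), C (c j i) * X ^ (d i) : ℝ[X]).eval y) with hΞ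
  have hlevel : ∀ y : ℝ, 0 < y → (∀ j, (∑ i ∈ Finset.range (T + 1), C (c j i) * X ^ (d i) : ℝ[X]).eval y ≠ 0) →
      (∑ j, y * (derivative (∑ i ∈ Finset.range (T + 1), C (c j i) * X ^ (d i) : ℝ[X])).eval y
          / (∑ i ∈ Finset.range (T + 1), C (c j i) * X ^ (d i) : ℝ[X]).eval y) = (m : ℝ) * (d 0 : ℝ) →
      Ξ y = 0 := by
    intro y hy hfy hl
    have hyw : y ^ (d T - d 0) ≠ 0 := pow_ne_zero _ hy.ne'
    have key : Ξ y * y ^ (d T - d 0)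
        = (∑ j, y * (derivative (∑ i ∈ Finset.range (T + 1), C (c j i) * X ^ (d i) : ℝ[X])).eval y
          / (∑ i ∈ Finset.range (T + 1), C (c j i) * X ^ (d i) : ℝ[X]).eval y) - (m : ℝ) * (d 0 : ℝ) := by
      rw [hΞ]; simp only
      rw [Finset.sum_mul]
      have : ((m : ℝ) * (d 0 : ℝ)) = ∑ _j : Fin m, ((d 0 : ℕ) : ℝ) := by simp
      rw [this, ← Finset.sum_sub_distrib]
      refine Finset.sum_congr rfl fun j _ => ?_
      have hfj := hfy j
      simp only [eval_sub, eval_mul, eval_X, eval_C]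
      field_simp
    rw [hl, sub_self] at key
    exact (mul_eq_zero.1 key).resolve_right hyw
  have hΞ1 : Ξ w₁ = 0 := hlevel w₁ hw₁pos (hfree w₁ ⟨le_rfl, hw₁₂.le⟩) h1
  have hΞ2 : Ξ w₂ = 0 := hlevel w₂ (hw₁pos.trans hw₁₂) (hfree w₂ ⟨hw₁₂.le, le_rfl⟩) h2
  have hm : 0 < m := Fin.pos j₀
  have hderiv : ∀ t ∈ Set.Icc w₁ w₂, ∃ D : ℝ, D < 0 ∧ HasDerivAt Ξ D t := by
    intro t ht
    have ht0 : 0 < t := hw₁pos.trans_le ht.1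
    choose D hD using fun j => hasDerivAt_lowerSignedXi T hT d hd (c j) (hls j) ht0 (hfree t ht j)
    refine ⟨∑ j, D j, ?_, ?_⟩
    · calc ∑ j, D j < ∑ _j : Fin m, (0 : ℝ) :=
          Finset.sum_lt_sum (fun j _ => (hD j).1) ⟨j₀, Finset.mem_univ _, (hD j₀).2.1 ⟨i₀, hi₀0, hi₀T, hci₀⟩⟩
        _ = 0 := by simp
    · have := HasDerivAt.fun_sum (u := Finset.univ) (fun j _ => (hD j).2.2)
      rw [hΞ]; exact this
  have hcont : ContinuousOn Ξ (Set.Icc w₁ w₂) := fun t ht => (hderiv t ht).elim fun D hD => hD.2.continuousAt.continuousWithinAt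
  obtain ⟨ξ, hξ, hξ'⟩ := exists_deriv_eq_zero hw₁₂ hcont (hΞ1.trans hΞ2.symm)
  obtain ⟨D, hDneg, hD⟩ := hderiv ξ ⟨hξ.1.le, hξ.2.le⟩
  rw [hD.deriv] at hξ'
  exact hDneg.ne hξ'

/-- ★★ **THE LOWER-SIGNED SECTOR, EVERY FORMAT, MEMBERS, SIGN-AWARE — line shape** (`2 ≤ K`, bottom coupling `l₀ = 0`):
`Z₊(C c·X^{m d_0} + ∏ f_j) ≤ #{j : ∃ l < K−1, a j l · a j (K−1) < 0} + 2` (so `≤ m + 2`; `≤ 2` if no factor changes sign). -/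
theorem lowerSigned_sector_classK_signed {m K : ℕ} (hK : 2 ≤ K) (d : Fin K → ℕ) (hd : StrictMono d) (a : Fin m → Fin K → ℝ)
    (hls : ∀ j, (∀ l : Fin K, (l : ℕ) < K - 1 → 0 ≤ a j l) ∨ (∀ l : Fin K, (l : ℕ) < K - 1 → a j l ≤ 0)) (c : ℝ) :
    ((C c * X ^ (m * d ⟨0, by omega⟩) + ∏ j, ∑ l, C (a j l) * X ^ (d l) : ℝ[X]).roots.toFinset.filter
      (fun t => 0 < t)).card
      ≤ (Finset.univ.filter (fun j => ∃ l : Fin K, (l : ℕ) < K - 1 ∧ a j l * a j ⟨K - 1, by omega⟩ < 0)).card + 2 := by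
  classical
  obtain ⟨K', rfl⟩ : ∃ K', K = K' + 1 := ⟨K - 1, by omega⟩
  have hK' : 1 ≤ K' := by omega
  set dx : ℕ → ℕ := fun i => if h : i < K' + 1 then d ⟨i, h⟩ else d ⟨K', by omega⟩ + (i - K') with hdx
  set cx : Fin m → ℕ → ℝ := fun j i => if h : i < K' + 1 then a j ⟨i, h⟩ else 0 with hcx
  have hdx_in : ∀ i (h : i < K' + 1), dx i = d ⟨i, h⟩ := fun i h => by simp only [hdx]; exact dif_pos h
  have hcx_in : ∀ j i (h : i < K' + 1), cx j i = a j ⟨i, h⟩ := fun j i h => by simp only [hcx]; exact dif_pos h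
  have hdmono : StrictMono dx := by
    intro i j hij
    by_cases hj : j < K' + 1
    · have hi : i < K' + 1 := by omega
      rw [hdx_in i hi, hdx_in j hj]
      exact hd (Fin.mk_lt_mk.mpr hij)
    · have ej : dx j = d ⟨K', by omega⟩ + (j - K') := by simp only [hdx]; exact dif_neg hj
      rw [ej]
      by_cases hi : i < K' + 1
      · rw [hdx_in i hi]
        have : d ⟨i, hi⟩ ≤ d ⟨K', by omega⟩ := hd.monotone (Fin.mk_le_mk.mpr (by omega))
        omega
      · have ei : dx i = d ⟨K', by omega⟩ + (i - K') := by simp only [hdx]; exact dif_neg hi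
        rw [ei]
        omega
  have hfac : ∀ j, (∑ l, C (a j l) * X ^ (d l) : ℝ[X]) = ∑ i ∈ Finset.range (K' + 1), C (cx j i) * X ^ (dx i) := by
    intro j
    rw [← Fin.sum_univ_eq_sum_range (fun i => C (cx j i) * X ^ (dx i)) (K' + 1)]
    refine Finset.sum_congr rfl (fun l _ => ?_)
    have hl : (l : ℕ) < K' + 1 := l.isLt
    simp only [hcx, hdx, dif_pos hl, Fin.eta]
  have hls' : ∀ j, (∀ i, i < K' → 0 ≤ cx j i) ∨ (∀ i, i < K' → cx j i ≤ 0) := by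
    intro j
    rcases hls j with h | h
    · refine Or.inl fun i hi => ?_
      rw [hcx_in j i (by omega)]
      exact h ⟨i, by omega⟩ (by simpa using hi)
    · refine Or.inr fun i hi => ?_
      rw [hcx_in j i (by omega)]
      exact h ⟨i, by omega⟩ (by simpa using hi)
  -- the sign-changing sets coincide
  have hS : (Finset.univ.filter (fun j => ∃ i, i < K' ∧ cx j i * cx j K' < 0))
      = Finset.univ.filter (fun j => ∃ l : Fin (K' + 1), (l : ℕ) < K' + 1 - 1 ∧ a j l * a j ⟨K' + 1 - 1, by omega⟩ < 0) := by
    refine Finset.filter_congr (fun j _ => ?_)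
    have eK : (⟨K' + 1 - 1, by omega⟩ : Fin (K' + 1)) = ⟨K', by omega⟩ := by ext; simp
    constructor
    · rintro ⟨i, hi, hlt⟩
      refine ⟨⟨i, by omega⟩, by simpa using hi, ?_⟩
      rw [hcx_in j i (by omega), hcx_in j K' (by omega)] at hlt
      rw [eK]; exact hlt
    · rintro ⟨l, hl, hlt⟩
      refine ⟨l, by simpa using hl, ?_⟩
      rw [hcx_in j l l.isLt, hcx_in j K' (by omega)]
      rw [eK] at hlt
      simpa using hlt
  rw [Finset.prod_congr rfl (fun j _ => hfac j)]
  have h0 : d ⟨0, by omega⟩ = dx 0 := by rw [hdx_in 0 (by omega)]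
  rw [h0, ← hS]
  exact lowerSignedK_sector_pos_roots_signed K' hK' dx hdmono cx hls' c

/-- **The `K = 3` row, members, sign-aware** (bottom coupling; `a_{j0}, a_{j1}` weakly one-signed per factor, `a_{j2}` free):
`Z₊(C c·X^{m d 0} + ∏ f_j) ≤ #{j : a_{j0}·a_{j2} < 0 ∨ a_{j1}·a_{j2} < 0} + 2`. [this file's theorem] -/
theorem classRowK3_lowerSigned_signed {m : ℕ} (d : Fin 3 → ℕ) (h01 : d 0 < d 1) (h12 : d 1 < d 2)
    (a : Fin m → Fin 3 → ℝ) (hls : ∀ j, (0 ≤ a j 0 ∧ 0 ≤ a j 1) ∨ (a j 0 ≤ 0 ∧ a j 1 ≤ 0)) (c : ℝ) :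
    ((C c * X ^ (m * d 0) + ∏ j, ∑ l, C (a j l) * X ^ (d l) : ℝ[X]).roots.toFinset.filter (fun t => 0 < t)).card
      ≤ (Finset.univ.filter (fun j => a j 0 * a j 2 < 0 ∨ a j 1 * a j 2 < 0)).card + 2 := by
  classical
  have hd : StrictMono d := by
    refine Fin.strictMono_iff_lt_succ.2 fun i => ?_
    fin_cases i
    · exact h01
    · exact h12
  have hls' : ∀ j, (∀ l : Fin 3, (l : ℕ) < 3 - 1 → 0 ≤ a j l) ∨ (∀ l : Fin 3, (l : ℕ) < 3 - 1 → a j l ≤ 0) := by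
    intro j
    rcases hls j with ⟨h0, h1⟩ | ⟨h0, h1⟩
    · refine Or.inl fun l hl => ?_
      fin_cases l
      · exact h0
      · exact h1
      · simp at hl
    · refine Or.inr fun l hl => ?_
      fin_cases l
      · exact h0
      · exact h1
      · simp at hl
  have h := lowerSigned_sector_classK_signed (by norm_num) d hd a hls' c
  have hS : (Finset.univ.filter (fun j => ∃ l : Fin 3, (l : ℕ) < 3 - 1 ∧ a j l * a j ⟨3 - 1, by omega⟩ < 0))
      = Finset.univ.filter (fun j => a j 0 * a j 2 < 0 ∨ a j 1 * a j 2 < 0) := by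
    refine Finset.filter_congr (fun j _ => ?_)
    have e2 : (⟨3 - 1, by omega⟩ : Fin 3) = 2 := rfl
    rw [e2]
    constructor
    · rintro ⟨l, hl, hlt⟩
      fin_cases l
      · exact Or.inl hlt
      · exact Or.inr hlt
      · simp at hl
    · rintro (h | h)
      · exact ⟨0, by simp, h⟩
      · exact ⟨1, by simp, h⟩
  rw [hS] at h
  exact h

end ProductPlusOne

end Summit.ValiantsHypothesis.ValiantsHypothesis.Theorems.LacunarySymmetroidMatrixDescartes
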